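import Mathlib
import Literature.AlgebraicGeometry.Resolution.ReducedQuadraticTransform
import HarnessLib

/-!
# Quadratic transforms of a reduced local ring, branch by branch (II): minimal primes, transforms

Topic: `Literature/AlgebraicGeometry/Resolution`. Sequel of `ReducedQuadraticTransform.lean`
(notation from there: `(R, 𝔪)` reduced Noetherian local, `𝔪 = (c)`, chart ring `B`, `S = B_𝔴`,
branch fields `K_q = Frac(R/q)`, branch maps `ψ_q : S → K_q` of the passing branches). PROVED:

* `eq_zero_of_forall_branchMap` — the `ψ_q` of the passing minimal primes jointly detect `0`, so
  `S` is reduced (`isReduced_of_isLocalization`);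
* `mem_minimalPrimes_iff`, `ker_branchMap_injective` — **the minimal primes of `S` are exactly the
  kernels `𝔔_q = ker ψ_q`**, distinct for distinct passing `q`;
* `isQuadraticTransform_range_branchMap` — **`S/𝔔_q ≅ ψ_q(S) ⊆ K_q` is a quadratic transform of
  the branch `θ_q(R) ≅ R/q`** (`QuadraticTransforms.IsQuadraticTransform`: the strict transform of
  a branch under the blowing up of the closed point is the blowing up of the branch);
* `exists_mem_ker_branchMap_mul` — for passing `q`, `q'` and `a ∈ q'`:
  `θ_q(a) = θ_q(c_i) · ψ_q(y)` with `y ∈ 𝔔_{q'}` (the contact order of two branches through the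
  same point drops);
* `isNoetherianRing_of_isLocalization` — `S` is Noetherian.

Consumer: finiteness of Krull's blow-up tower of a one-dimensional local ring with reduced
completion (Kollár 2007, Thm. 1.101; `OneDimensionalBlowupTower.lean`, F-45).

## Sources

* J. Kollár, *Lectures on Resolution of Singularities*, Ann. of Math. Stud. 166 (2007), §1.4,
  Alg. 1.100, Thm. 1.101. [Kollar2007]
* M. Herrmann, S. Ikeda, U. Orbanz, *Equimultiplicity and Blowing up* (1988), Ch. II and proof of
  Thm. (30.2). [HerrmannIkedaOrbanz1988]
-/

noncomputable section

open IsLocalRing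

namespace Literature.AlgebraicGeometry.Resolution

universe u

variable {R : Type u} [CommRing R] {n : ℕ} (c : Fin n → R) (i : Fin n)

-- the chart ring `chartRing c i = (R[𝔪t])_{(c_i t)}` and its base map `chartBase c i`
-- (`BlowupChartRsop.lean`; the raw `HomogeneousLocalization.Away …` of `QuadraticTransformAlongPrime.lean`)
local notation3 "𝓑" => chartRing c i
local notation3 "φ" => chartBase c i

/-! ## Reducedness and the minimal primes of `S` -/

section Structure

variable [IsReduced R] [IsNoetherianRing R]
  (𝔴 : Ideal (chartRing c i)) [𝔴.IsPrime] (S : Type u) [CommRing S]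
  [Algebra (chartRing c i) S] [IsLocalization.AtPrime S 𝔴]

/-- A product over a finset of elements outside a prime ideal lies outside it. [folklore] -/
private theorem prod_not_mem {A : Type*} [CommRing A] (P : Ideal A) [P.IsPrime] {ι : Type*}
    (F : Finset ι) (f : ι → A) (hf : ∀ j ∈ F, f j ∉ P) : (∏ j ∈ F, f j) ∉ P := by
  classical
  induction F using Finset.induction_on with
  | empty => rw [Finset.prod_empty]; exact fun h => Ideal.IsPrime.ne_top' (Ideal.eq_top_of_isUnit_mem _ h isUnit_one)
  | insert a F ha ih =>
    rw [Finset.prod_insert ha]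
    intro hmem
    rcases Ideal.IsPrime.mem_or_mem ‹P.IsPrime› hmem with h | h
    · exact hf a (Finset.mem_insert_self a F) h
    · exact ih (fun j hj => hf j (Finset.mem_insert_of_mem hj)) h

/-- **The branch maps jointly detect `0`**: if `ψ_q(x) = 0` for every minimal prime `q ∌ c_i`
whose branch passes through `𝔴`, then `x = 0` (so `S` embeds into `∏_q Frac(R/q)` over the
passing branches). Proof: the non-passing branches are killed by an element `U ∉ 𝔴` of the chart
ring; apply `chart_eq_zero_of_forall_chartToField` to `U ·` numerator. [cite: Kollar2007, §1.4] -/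
theorem eq_zero_of_forall_branchMap (x : S)
    (hx : ∀ (q : Ideal R) [q.IsPrime], q ∈ minimalPrimes R → ∀ (hq : c i ∉ q)
      (hpass : RingHom.ker (chartBranchMap c i q hq) ≤ 𝔴), branchMap c i q hq 𝔴 S hpass x = 0) : x = 0 := by
  classical
  obtain ⟨b, s, rfl⟩ := IsLocalization.exists_mk'_eq 𝔴.primeCompl x
  -- an element `U ∉ 𝔴` lying in the strict transform of every NON-passing branch
  let F : Finset (Ideal R) := (minimalPrimes.finite_of_isNoetherianRing (R := R)).toFinset
  have hF : ∀ q, q ∈ F ↔ q ∈ minimalPrimes R := fun q => Set.Finite.mem_toFinset _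
  let u : Ideal R → 𝓑 := fun q =>
    if h : ∃ (hp : q.IsPrime) (hq : c i ∉ q), ¬ RingHom.ker (@chartBranchMap R _ n c i q hp hq) ≤ 𝔴 then
      (SetLike.not_le_iff_exists.mp h.2.2).choose else 1
  have hu1 : ∀ q, u q ∉ 𝔴 := by
    intro q
    by_cases h : ∃ (hp : q.IsPrime) (hq : c i ∉ q), ¬ RingHom.ker (@chartBranchMap R _ n c i q hp hq) ≤ 𝔴
    · simp only [u, dif_pos h]
      exact (SetLike.not_le_iff_exists.mp h.2.2).choose_spec.2
    · simp only [u, dif_neg h]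
      exact fun h1 => Ideal.IsPrime.ne_top' (Ideal.eq_top_of_isUnit_mem _ h1 isUnit_one)
  have hu2 : ∀ (q : Ideal R) (hp : q.IsPrime) (hq : c i ∉ q), ¬ RingHom.ker (chartBranchMap c i q hq) ≤ 𝔴 →
      chartBranchMap c i q hq (u q) = 0 := by
    intro q hp hq hnp
    have h : ∃ (hp : q.IsPrime) (hq : c i ∉ q), ¬ RingHom.ker (@chartBranchMap R _ n c i q hp hq) ≤ 𝔴 := ⟨hp, hq, hnp⟩
    simp only [u, dif_pos h]
    exact (SetLike.not_le_iff_exists.mp h.2.2).choose_spec.1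
  let U : 𝓑 := ∏ q ∈ F, u q
  have hU : U ∉ 𝔴 := prod_not_mem 𝔴 F u fun q _ => hu1 q
  -- `U b` is killed by every `θ_{q,1}`
  have hUb : U * b = 0 := by
    refine chart_eq_zero_of_forall_chartToField c i (U * b) fun q _ hqmin hq => ?_
    rw [map_mul]
    by_cases hpass : RingHom.ker (chartBranchMap c i q hq) ≤ 𝔴
    · have h0 := hx q hqmin hq hpass
      rw [branchMap_mk'_eq_zero_iff] at h0
      rw [h0, mul_zero]
    · have : chartBranchMap c i q hq U = 0 := by
        rw [map_prod]
        exact Finset.prod_eq_zero ((hF q).mpr hqmin) (hu2 q _ hq hpass)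
      rw [this, zero_mul]
  -- hence `b/s = 0`
  have hb0 : (algebraMap (chartRing c i) S : chartRing c i →+* S) b = 0 := by
    have h1 : (algebraMap (chartRing c i) S : chartRing c i →+* S) (U * b) = 0 := by
      rw [hUb, map_zero]
    rw [map_mul] at h1
    exact ((IsLocalization.map_units S (⟨U, hU⟩ : 𝔴.primeCompl)).mul_right_eq_zero).mp h1
  rw [IsLocalization.mk'_eq_mul_mk'_one, hb0, zero_mul]

include c i 𝔴 in
/-- **`S` is reduced.** [cite: Kollar2007, §1.4] -/
theorem isReduced_of_isLocalization : IsReduced S := by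
  refine ⟨fun x hx => eq_zero_of_forall_branchMap c i 𝔴 S x fun q _ hqmin hq hpass => ?_⟩
  exact (hx.map (branchMap c i q hq 𝔴 S hpass)).eq_zero

/-- Every prime of `S` contains the kernel `ker ψ_q` of some passing branch. [cite: Kollar2007, §1.4] -/
theorem exists_ker_branchMap_le (P : Ideal S) [P.IsPrime] :
    ∃ (q : Ideal R) (_ : q.IsPrime) (_ : q ∈ minimalPrimes R) (hq : c i ∉ q)
      (hpass : RingHom.ker (chartBranchMap c i q hq) ≤ 𝔴), RingHom.ker (branchMap c i q hq 𝔴 S hpass) ≤ P := by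
  classical
  by_contra hcon'
  have hcon : ∀ (q : Ideal R) (hp : q.IsPrime) (_ : q ∈ minimalPrimes R) (hq : c i ∉ q)
      (hpass : RingHom.ker (chartBranchMap c i q hq) ≤ 𝔴), ¬ RingHom.ker (branchMap c i q hq 𝔴 S hpass) ≤ P :=
    fun q hp hm hq hpass hle => hcon' ⟨q, hp, hm, hq, hpass, hle⟩
  -- for every passing branch pick `y_q ∈ ker ψ_q ∖ P`; their product is `0 ∈ P`
  let F : Finset (Ideal R) := (minimalPrimes.finite_of_isNoetherianRing (R := R)).toFinset
  have hF : ∀ q, q ∈ F ↔ q ∈ minimalPrimes R := fun q => Set.Finite.mem_toFinset _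
  let y : Ideal R → S := fun q =>
    if h : ∃ (hp : q.IsPrime) (hm : q ∈ minimalPrimes R) (hq : c i ∉ q),
        RingHom.ker (@chartBranchMap R _ n c i q hp hq) ≤ 𝔴 then
      (SetLike.not_le_iff_exists.mp (hcon q h.1 h.2.1 h.2.2.1 h.2.2.2)).choose else 1
  have hy1 : ∀ q, y q ∉ P := by
    intro q
    by_cases h : ∃ (hp : q.IsPrime) (hm : q ∈ minimalPrimes R) (hq : c i ∉ q),
        RingHom.ker (@chartBranchMap R _ n c i q hp hq) ≤ 𝔴
    · simp only [y, dif_pos h]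
      exact (SetLike.not_le_iff_exists.mp (hcon q h.1 h.2.1 h.2.2.1 h.2.2.2)).choose_spec.2
    · simp only [y, dif_neg h]
      exact fun h1 => Ideal.IsPrime.ne_top' (Ideal.eq_top_of_isUnit_mem _ h1 isUnit_one)
  have hY : (∏ q ∈ F, y q) ∉ P := prod_not_mem P F y fun q _ => hy1 q
  apply hY
  have hzero : (∏ q ∈ F, y q) = 0 := by
    refine eq_zero_of_forall_branchMap c i 𝔴 S _ fun q hp hqmin hq hpass => ?_
    rw [map_prod]
    refine Finset.prod_eq_zero ((hF q).mpr hqmin) ?_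
    have h : ∃ (hp : q.IsPrime) (hm : q ∈ minimalPrimes R) (hq : c i ∉ q),
        RingHom.ker (@chartBranchMap R _ n c i q hp hq) ≤ 𝔴 := ⟨hp, hqmin, hq, hpass⟩
    simp only [y, dif_pos h]
    exact (SetLike.not_le_iff_exists.mp (hcon q h.1 h.2.1 h.2.2.1 h.2.2.2)).choose_spec.1
  rw [hzero]
  exact P.zero_mem

omit [IsReduced R] [IsNoetherianRing R] in
/-- For distinct minimal primes `q ≠ q'` (both avoiding `c_i`, `q'` passing, `q` passing) the
kernels are not nested: `φ(a)`, `a ∈ q' ∖ q`, lies in `ker ψ_{q'}` but not in `ker ψ_q`.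
[cite: Kollar2007, §1.4] -/
theorem ker_branchMap_not_le {q q' : Ideal R} [q.IsPrime] [q'.IsPrime]
    (hqm : q ∈ minimalPrimes R) (hq : c i ∉ q) (hq' : c i ∉ q')
    (hpass : RingHom.ker (chartBranchMap c i q hq) ≤ 𝔴) (hpass' : RingHom.ker (chartBranchMap c i q' hq') ≤ 𝔴) (hne : q ≠ q') :
    ¬ RingHom.ker (branchMap c i q' hq' 𝔴 S hpass') ≤ RingHom.ker (branchMap c i q hq 𝔴 S hpass) := by
  -- `q' ⊄ q` by minimality of `q`
  have hnle : ¬ q' ≤ q := fun hle => hne (le_antisymm (hqm.2 ⟨‹q'.IsPrime›, bot_le⟩ hle) hle)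
  obtain ⟨a, ha', ha⟩ := SetLike.not_le_iff_exists.mp hnle
  intro hle
  have h1 : (algebraMap (chartRing c i) S : chartRing c i →+* S) (φ a) ∈
      RingHom.ker (branchMap c i q' hq' 𝔴 S hpass') := by
    rw [RingHom.mem_ker, branchMap_algebraMap_reesChartBase, branchPoint_eq_zero_iff]
    exact ha'
  have h2 := hle h1
  rw [RingHom.mem_ker, branchMap_algebraMap_reesChartBase, branchPoint_eq_zero_iff] at h2
  exact ha h2

/-- **The minimal primes of `S` are exactly the kernels `ker ψ_q` of the branch maps of the
passing minimal primes `q` of `R`.** [cite: Kollar2007, §1.4] -/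
theorem mem_minimalPrimes_iff (P : Ideal S) :
    P ∈ minimalPrimes S ↔ ∃ (q : Ideal R) (_ : q.IsPrime) (_ : q ∈ minimalPrimes R) (hq : c i ∉ q)
      (hpass : RingHom.ker (chartBranchMap c i q hq) ≤ 𝔴), P = RingHom.ker (branchMap c i q hq 𝔴 S hpass) := by
  constructor
  · intro hP
    haveI := hP.1.1
    obtain ⟨q, hp, hqm, hq, hpass, hle⟩ := exists_ker_branchMap_le c i 𝔴 S P
    exact ⟨q, hp, hqm, hq, hpass,
      le_antisymm (hP.2 ⟨RingHom.ker_isPrime _, bot_le⟩ hle) hle⟩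
  · rintro ⟨q, hp, hqm, hq, hpass, rfl⟩
    refine ⟨⟨RingHom.ker_isPrime _, bot_le⟩, fun P' ⟨hP', _⟩ hle => ?_⟩
    haveI := hP'
    obtain ⟨q', hp', hqm', hq', hpass', hle'⟩ := exists_ker_branchMap_le c i 𝔴 S P'
    by_cases hqq : q' = q
    · subst hqq; exact hle'
    · exact absurd (hle'.trans hle) (ker_branchMap_not_le c i 𝔴 S hqm hq hq' hpass hpass' fun h => hqq h.symm)

omit [IsReduced R] [IsNoetherianRing R] in
/-- Distinct passing minimal primes have distinct kernels. [cite: Kollar2007, §1.4] -/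
theorem ker_branchMap_injective {q q' : Ideal R} [q.IsPrime] [q'.IsPrime]
    (hqm : q ∈ minimalPrimes R) (hq : c i ∉ q) (hq' : c i ∉ q')
    (hpass : RingHom.ker (chartBranchMap c i q hq) ≤ 𝔴) (hpass' : RingHom.ker (chartBranchMap c i q' hq') ≤ 𝔴)
    (h : RingHom.ker (branchMap c i q hq 𝔴 S hpass) = RingHom.ker (branchMap c i q' hq' 𝔴 S hpass')) :
    q = q' := by
  by_contra hne
  exact ker_branchMap_not_le c i 𝔴 S hqm hq hq' hpass hpass' hne h.ge

end Structure

/-! ## The branches of `S` are quadratic transforms of the branches of `R` -/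

section Transform

variable [IsLocalRing R] (hc : Ideal.span (Set.range c) = maximalIdeal R)
  (q : Ideal R) [q.IsPrime] (hq : c i ∉ q)
  (𝔴 : Ideal (chartRing c i)) [𝔴.IsPrime] (h𝔴 : 𝔴.comap (chartBase c i) = maximalIdeal R)
  (S : Type u) [CommRing S] [Algebra (chartRing c i) S] [IsLocalization.AtPrime S 𝔴]
  (hpass : RingHom.ker (chartBranchMap c i q hq) ≤ 𝔴)

/-- `S/ker ψ_q ≅ ψ_q(S)`: the local ring of the strict transform of the branch `V(q)` at the
point `𝔴`, realised inside `Frac(R/q)`. [cite: Kollar2007, §1.4] -/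
def quotientKerBranchMapEquiv :
    S ⧸ RingHom.ker (branchMap c i q hq 𝔴 S hpass) ≃+* (branchMap c i q hq 𝔴 S hpass).range :=
  RingHom.quotientKerEquivRange _

omit [IsLocalRing R] in
/-- `θ_q(R) ⊆ ψ_q(S)`. [cite: Kollar2007, §1.4] -/
theorem range_branchPoint_le_range_branchMap :
    (branchPoint q).range ≤ (branchMap c i q hq 𝔴 S hpass).range := by
  rintro _ ⟨r, rfl⟩
  exact ⟨(algebraMap (chartRing c i) S : chartRing c i →+* S) (φ r),
    branchMap_algebraMap_reesChartBase S hpass r⟩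

omit [IsLocalRing R] in
/-- `θ_{q,1}(B) ⊆ ψ_q(S)`. [cite: Kollar2007, §1.4] -/
theorem range_chartBranchMap_le_range_branchMap :
    RingHom.range (R := chartRing c i) (S := FractionRing (R ⧸ q)) (chartBranchMap c i q hq) ≤
      (branchMap c i q hq 𝔴 S hpass).range := by
  rintro _ ⟨b, rfl⟩
  exact ⟨(algebraMap (chartRing c i) S : chartRing c i →+* S) b, branchMap_algebraMap S hpass b⟩

include h𝔴 in
/-- For `r ∈ 𝔪_R`, the image of `r` in `S` is a non-unit (it lies in `𝔴 S = 𝔪_S`). [folklore] -/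
private theorem not_isUnit_algebraMap_of_mem {r : R} (hr : r ∈ maximalIdeal R) :
    ¬ IsUnit ((algebraMap (chartRing c i) S : chartRing c i →+* S) (φ r)) := by
  intro hu
  have h1 : φ r ∈ 𝔴.primeCompl := (IsLocalization.AtPrime.isUnit_to_map_iff S 𝔴 (φ r)).mp hu
  apply h1
  change r ∈ 𝔴.comap φ
  rw [h𝔴]; exact hr

include hc h𝔴 in
/-- **The branch of `S` on `V(q)` is a quadratic transform of the branch `θ_q(R) ≅ R/q`**:
`ψ_q(S) = (θ_q(R)[𝔪/θ_q(c_i)])_𝔫` inside `Frac(R/q)`, dominating `θ_q(R)` — the strict transform of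
a branch under the blowing up of the closed point is the blowing up of the branch.
[cite: Kollar2007, §1.4] [cite: HerrmannIkedaOrbanz1988, Thm. (30.2) (proof), b)] -/
theorem isQuadraticTransform_range_branchMap :
    IsQuadraticTransform (branchPoint q).range (branchMap c i q hq 𝔴 S hpass).range := by
  haveI := isLocalRing_range_branchPoint q (R := R)
  haveI := IsLocalization.AtPrime.isLocalRing S 𝔴
  haveI : IsLocalRing (branchMap c i q hq 𝔴 S hpass).range :=
    IsLocalRing.of_surjective' (branchMap c i q hq 𝔴 S hpass).rangeRestrict
      (branchMap c i q hq 𝔴 S hpass).rangeRestrict_surjective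
  set ψ := branchMap c i q hq 𝔴 S hpass with hψ
  have hθ0 : branchPoint q (c i) ≠ 0 := (branchPoint_ne_zero_iff q _).mpr hq
  -- the element `x = θ_q(c_i)`
  let x : (branchPoint q).range := ⟨branchPoint q (c i), ⟨c i, rfl⟩⟩
  have hx : x ∈ maximalIdeal (branchPoint q).range :=
    (mem_maximalIdeal _).mpr (not_isUnit_rangeRestrict_branchPoint q
      (hc ▸ Ideal.subset_span ⟨i, rfl⟩ : c i ∈ maximalIdeal R))
  have hx0 : x ≠ 0 := fun e => hθ0 (congrArg Subtype.val e)
  -- `θ_q(R)[𝔪/x] = θ_{q,1}(B)`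
  have hblow : blowupRing (branchPoint q).range (x : FractionRing (R ⧸ q)) =
      RingHom.range (R := chartRing c i) (S := FractionRing (R ⧸ q)) (chartBranchMap c i q hq) :=
    (range_chartToField_eq_blowupRing c i (branchPoint q) hθ0 hc (branchPoint q).range rfl).symm
  refine ⟨‹_›, x, hx, hx0, ‹_›, ?_, ?_, ?_⟩
  · rw [hblow]; exact range_chartBranchMap_le_range_branchMap c i q hq 𝔴 S hpass
  · rintro _ ⟨z, rfl⟩
    obtain ⟨b, s, rfl⟩ := IsLocalization.exists_mk'_eq 𝔴.primeCompl z
    refine ⟨chartBranchMap c i q hq b, hblow ▸ ⟨b, rfl⟩, chartBranchMap c i q hq s, hblow ▸ ⟨(s : 𝓑), rfl⟩,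
      ⟨IsLocalization.mk' S 1 s, ?_⟩, branchMap_mk' S hpass b s⟩
    rw [branchMap_mk', map_one, one_div]
  · refine ⟨range_branchPoint_le_range_branchMap c i q hq 𝔴 S hpass, ?_⟩
    rintro _ ⟨r, rfl⟩ hinv
    by_cases hr : r ∈ maximalIdeal R
    · -- `θ_q(r)` is not invertible in `ψ_q(S)` unless it is `0`
      by_cases h0 : branchPoint q r = 0
      · rw [h0, inv_zero]; exact ⟨0, map_zero _⟩
      · exfalso
        obtain ⟨y, hy⟩ := hinv
        have hunit : ¬ IsUnit ((algebraMap (chartRing c i) S : chartRing c i →+* S) (φ r)) :=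
          not_isUnit_algebraMap_of_mem c i 𝔴 h𝔴 S hr
        have hmem : (algebraMap (chartRing c i) S : chartRing c i →+* S) (φ r) ∈ maximalIdeal S :=
          (mem_maximalIdeal _).mpr hunit
        have hker : (algebraMap (chartRing c i) S : chartRing c i →+* S) (φ r) * y - 1 ∈ RingHom.ker ψ := by
          rw [RingHom.mem_ker, map_sub, map_mul, map_one, hψ, branchMap_algebraMap_reesChartBase, ← hψ,
            hy, mul_inv_cancel₀ h0, sub_self]
        have hker' : RingHom.ker ψ ≤ maximalIdeal S :=
          IsLocalRing.le_maximalIdeal (RingHom.ker_ne_top ψ)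
        have h1 : (1 : S) ∈ maximalIdeal S := by
          have := (maximalIdeal S).sub_mem (Ideal.mul_mem_right y _ hmem) (hker' hker)
          rwa [sub_sub_cancel] at this
        exact (maximalIdeal.isMaximal S).ne_top (Ideal.eq_top_of_isUnit_mem _ h1 isUnit_one)
    · obtain ⟨u, rfl⟩ := not_not.mp ((mem_maximalIdeal _).not.mp hr)
      exact ⟨((u⁻¹ : Rˣ) : R), map_units_inv (branchPoint q) u⟩

end Transform

/-! ## Noetherianity; separation of two branches through the same point -/

section Pair

variable (𝔴 : Ideal (chartRing c i)) [𝔴.IsPrime]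
  (S : Type u) [CommRing S] [Algebra (chartRing c i) S] [IsLocalization.AtPrime S 𝔴]

include 𝔴 in
/-- `S = B_𝔴` is Noetherian when `R` is. [cite: Kollar2007, §1.4] -/
theorem isNoetherianRing_of_isLocalization [IsNoetherianRing R] : IsNoetherianRing S :=
  haveI := isNoetherianRing_chart c i
  IsLocalization.isNoetherianRing 𝔴.primeCompl S inferInstance

variable [IsLocalRing R] (hc : Ideal.span (Set.range c) = maximalIdeal R)

include hc in
/-- For `a ∈ q'`, `φ(a) = φ(c_i) · b` with `b` in the strict transform `ker θ_{q',1}` of the branch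
`V(q')` (the total transform of the branch is the exceptional divisor times the strict transform).
[cite: Kollar2007, §1.4] -/
theorem exists_chartBranchMap_eq_zero_mul (q' : Ideal R) [q'.IsPrime] (hq' : c i ∉ q') {a : R}
    (ha : a ∈ q') : ∃ b : 𝓑, chartBranchMap c i q' hq' b = 0 ∧ φ a = φ (c i) * b := by
  have hmem := Ideal.mem_span_range_self (f := c) (x := i)
  have ha𝔪 : a ∈ Ideal.span (Set.range c) := by
    rw [hc]; exact IsLocalRing.le_maximalIdeal Ideal.IsPrime.ne_top' ha
  have h1 : φ a ∈ Ideal.span (φ '' (Ideal.span (Set.range c) : Set R)) :=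
    Ideal.subset_span ⟨a, ha𝔪, rfl⟩
  rw [span_image_reesChartBase_eq] at h1
  obtain ⟨b, hb⟩ := Ideal.mem_span_singleton'.mp h1
  refine ⟨b, ?_, ?_⟩
  · have hθ0 : branchPoint q' (c i) ≠ 0 := (branchPoint_ne_zero_iff q' _).mpr hq'
    have h2 := congrArg (chartBranchMap c i q' hq') hb
    rw [map_mul, chartToField_reesChartBase, chartToField_reesChartBase,
      (branchPoint_eq_zero_iff q' a).mpr ha, mul_eq_zero] at h2
    exact h2.resolve_right hθ0
  · rw [← hb]; exact mul_comm b (φ (c i))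

include hc in
/-- **Separation of branches.** Let the branches `V(q)`, `V(q')` both pass through `𝔴`. Then for
`a ∈ q'`: `θ_q(a) = θ_q(c_i) · ψ_q(y)` with `y ∈ ker ψ_{q'}` — on the branch `q` the image of the
other branch's ideal is divisible by the exceptional parameter, with quotient in the image of the
other branch's NEW ideal. [cite: Kollar2007, §1.4] -/
theorem exists_mem_ker_branchMap_mul (q q' : Ideal R) [q.IsPrime] [q'.IsPrime]
    (hq : c i ∉ q) (hq' : c i ∉ q')
    (hpass : RingHom.ker (chartBranchMap c i q hq) ≤ 𝔴) (hpass' : RingHom.ker (chartBranchMap c i q' hq') ≤ 𝔴) {a : R} (ha : a ∈ q') :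
    ∃ y ∈ RingHom.ker (branchMap c i q' hq' 𝔴 S hpass'),
      branchPoint q a = branchPoint q (c i) * branchMap c i q hq 𝔴 S hpass y := by
  obtain ⟨b, hb0, hb⟩ := exists_chartBranchMap_eq_zero_mul c i hc q' hq' ha
  refine ⟨(algebraMap (chartRing c i) S : chartRing c i →+* S) b, ?_, ?_⟩
  · rw [RingHom.mem_ker, branchMap_algebraMap]; exact hb0
  · rw [branchMap_algebraMap, ← chartToField_reesChartBase c i (branchPoint q)
      ((branchPoint_ne_zero_iff q _).mpr hq) a, hb, map_mul, chartToField_reesChartBase]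

end Pair

end Literature.AlgebraicGeometry.Resolution
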